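import Literature.AlgebraicGeometry.Resolution.AlterationsSemiStableCodimTwo
import Literature.AlgebraicGeometry.Resolution.SemiStableCurvesReduced
import Literature.AlgebraicGeometry.Motives.CyclesEquivalencesProofs
import Mathlib.RingTheory.KrullDimension.Zero
import Mathlib.RingTheory.KrullDimension.Field
import HarnessLib

/-!
# `codim(Sing(X), X) ≥ 2` for a semi-stable curve over a regular base (de Jong 1996, 3.4) — proof

Topic: `Literature/AlgebraicGeometry/Resolution`. Discharges the named fact
`DeJong1996SemiStableSingCodimTwo` of `AlterationsSemiStableCodimTwo.lean` (de Jong 1996, 3.4: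
"(Note that `codim(Sing(X), X) ≥ 2`, either by the formulae above, or by noting that `X` is
normal.)", rendered for a pair in Situation 4.23: every non-regular point `x` of `X` has
`dim 𝒪_{X,x} ≥ 2`), by the `R₁` part of the normality argument:

* `IsRegularLocalRing.of_flat_of_isField_quotient` — **Matsumura, Thm. 23.7 (ii), the case of a
  field fibre**: if `A → B` is a flat local homomorphism of Noetherian local rings, `A` is
  regular and `B/𝔪_A B` is a field, then `B` is regular (`𝔪_B = 𝔪_A B` is generated by
  `dim A = dim B` elements, EGA IV₂ 6.1.2 for the dimension);
  `isRegularLocalRing_stalk_of_isField_stalk_fiber` — the same on a flat morphism of schemes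
  `f : X → Y` at a point `x` which is generic in its fibre with reduced local ring
  `𝒪_{X_{f x}, x}` a field (`𝒪_{X_{f x}, x} ≅ 𝒪_{X,x}/𝔪_{f x}𝒪_{X,x}`,
  `Motives.nonempty_stalkFiber_ringEquiv_asFiber`);
* `DeJong1996SemiStableSingCodimTwo_holds` — THE DISCHARGE. For `(f : X → Y, g, D, τ)` in
  Situation 4.23 and `x ∈ X` non-regular: `x` lies in no open on which `f` is smooth (3.1,
  `Sing(X) ⊆ Sing(f)`: smooth over the regular `Y` is regular, EGA IV₄ 17.5.8 (iii)), so
  `s = f(x) ∈ D` and `dim 𝒪_{Y,s} ≥ 1` (2.4); by flatness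
  `dim 𝒪_{X,x} = dim 𝒪_{Y,s} + dim 𝒪_{X_s,x}` (EGA IV₂ 6.1.2,
  `Motives.coheight_eq_coheight_add_ringKrullDim_stalk_fiber`); and `dim 𝒪_{X_s,x} ≥ 1`, for
  otherwise the reduced (the fibres of a semi-stable curve are reduced, 2.21,
  `IsSemiStableCurve.isReduced_fiber`) zero-dimensional local ring `𝒪_{X_s,x}` is a field and
  `𝒪_{X,x}` would be regular. Hence `dim 𝒪_{X,x} ≥ 2`.

With `AlterationsSemiStableCodimTwo.lean` this leaves de Jong's Lemma 3.2 (`DeJong1996Lemma32`)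
resting on the single named fact `DeJong1996SemiStableCodimTwoModification` (3.3–3.4):
`DeJong1996Lemma32.of_codimTwoModification`.

## Sources

* A. J. de Jong, *Smoothness, semi-stability and alterations*, Publ. Math. IHÉS 83 (1996),
  2.21 (p. 61), 3.1, 3.4 (pp. 62–63), 4.23 (p. 75).
* H. Matsumura, *Commutative Ring Theory* (1986), Thm. 23.7 (ii); Thm. 15.1 (dimension of
  flat local extensions), via `Motives.ringKrullDim_eq_add_of_flat_of_isLocalHom`.
* A. Grothendieck, J. Dieudonné, *EGA IV₂*, Cor. 6.1.2; *EGA IV₄*, Prop. 17.5.8 (iii).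
-/

noncomputable section

open CategoryTheory CategoryTheory.Limits AlgebraicGeometry TopologicalSpace IsLocalRing Order

namespace Literature.AlgebraicGeometry.Resolution

universe u

/-! ## Matsumura 23.7 (ii) with a field fibre -/

/-- **Regularity ascends along a flat local homomorphism with field fibre** (Matsumura,
*Commutative Ring Theory*, Thm. 23.7 (ii): "`A → B` flat local, `A` and `B/𝔪_A B` regular
`⇒ B` regular", in the case where the closed fibre `B/𝔪_A B` is a field): then `𝔪_B = 𝔪_A B`
is generated by the images of `dim A` generators of `𝔪_A`, while `dim B = dim A + dim B/𝔪_A B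
= dim A` (Thm. 15.1). [cite: Matsumura1987, Thm. 23.7 (ii)] -/
theorem IsRegularLocalRing.of_flat_of_isField_quotient {A B : Type*} [CommRing A] [CommRing B]
    [IsRegularLocalRing A] [IsLocalRing B] [IsNoetherianRing B] [Algebra A B]
    [IsLocalHom (algebraMap A B)] [Module.Flat A B]
    (hF : IsField (B ⧸ (maximalIdeal A).map (algebraMap A B))) : IsRegularLocalRing B := by
  set I : Ideal B := (maximalIdeal A).map (algebraMap A B) with hI
  have hImax : I.IsMaximal := Ideal.Quotient.maximal_of_isField I hF
  have hIeq : I = maximalIdeal B := IsLocalRing.eq_maximalIdeal hImax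
  have hdim : ringKrullDim B = ringKrullDim A := by
    rw [Literature.AlgebraicGeometry.Motives.ringKrullDim_eq_add_of_flat_of_isLocalHom A B, ← hI,
      ringKrullDim_eq_zero_of_isField hF, add_zero]
  refine IsRegularLocalRing.of_spanFinrank_maximalIdeal_le B ?_
  have h1 : (maximalIdeal B).spanFinrank ≤ (maximalIdeal A).spanFinrank := by
    rw [← hIeq, hI]
    exact Ideal.spanFinrank_map_le_of_fg (algebraMap A B) (IsNoetherian.noetherian _)
  calc ((maximalIdeal B).spanFinrank : WithBot ℕ∞) ≤ (maximalIdeal A).spanFinrank := by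
        exact_mod_cast h1
    _ = ringKrullDim A := IsRegularLocalRing.spanFinrank_maximalIdeal
    _ = ringKrullDim B := hdim.symm

/-- **A flat morphism to a regular point whose fibre is a field at `x` is regular at `x`**: for
`f : X → Y` flat with `X` locally Noetherian, if `𝒪_{Y, f x}` is regular and the local ring
`𝒪_{X_{f x}, x}` of the scheme-theoretic fibre at `x` is a field (e.g. `x` a generic point of a
reduced fibre), then `𝒪_{X,x}` is regular — `𝒪_{X_{f x}, x} ≅ 𝒪_{X,x}/𝔪_{f x}𝒪_{X,x}`
(`Motives.nonempty_stalkFiber_ringEquiv_asFiber`) and Matsumura 23.7 (ii).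
[cite: Matsumura1987, Thm. 23.7 (ii)] -/
theorem isRegularLocalRing_stalk_of_isField_stalk_fiber {X Y : Scheme.{u}} (f : X ⟶ Y) [Flat f]
    [IsLocallyNoetherian X] (x : X) (hy : IsRegularLocalRing (Y.presheaf.stalk (f x)))
    (hF : IsField ((f.fiber (f x)).presheaf.stalk (f.asFiber x))) :
    IsRegularLocalRing (X.presheaf.stalk x) := by
  let A : Type u := Y.presheaf.stalk (f x)
  let B : Type u := X.presheaf.stalk x
  letI : Algebra A B := (f.stalkMap x).hom.toAlgebra
  haveI : IsLocalHom (algebraMap A B) := inferInstanceAs (IsLocalHom (f.stalkMap x).hom)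
  haveI : Module.Flat A B := Flat.stalkMap f x
  obtain ⟨e⟩ := Literature.AlgebraicGeometry.Motives.nonempty_stalkFiber_ringEquiv_asFiber f x
  have hF' : IsField (B ⧸ (maximalIdeal A).map (algebraMap A B)) :=
    MulEquiv.isField hF e.symm.toMulEquiv
  exact IsRegularLocalRing.of_flat_of_isField_quotient hF'

/-! ## The discharge -/

/-- The Krull dimension of a Noetherian local ring which is not `≥ 1` is `≤ 0`. [folklore] -/
theorem ringKrullDim_le_zero_of_not_one_le (R : Type u) [CommRing R] [IsLocalRing R]
    [IsNoetherianRing R] (h : ¬ (1 : WithBot ℕ∞) ≤ ringKrullDim R) : ringKrullDim R ≤ 0 := by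
  obtain ⟨n, hn⟩ := exists_ringKrullDim_eq_natCast R
  rw [hn] at h ⊢
  have hn0 : n = 0 := by
    by_contra hne
    exact h (by exact_mod_cast Nat.one_le_iff_ne_zero.mpr hne)
  subst hn0
  exact le_rfl

/-- **de Jong 1996, 3.4: `codim(Sing(X), X) ≥ 2` — THE DISCHARGE of
`DeJong1996SemiStableSingCodimTwo`.** For a pair `(f : X → Y, g, D, τ)` in Situation 4.23 over an
algebraically closed field and a non-regular point `x ∈ X`: `x` lies in no open on which `f` is
smooth (3.1: smooth over the regular `Y` is regular), in particular `s = f(x) ∈ D`, so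
`dim 𝒪_{Y,s} ≥ 1` (the strict normal crossings divisor `D` has local rings of dimension
`r + e ≥ 1`); `dim 𝒪_{X,x} = dim 𝒪_{Y,s} + dim 𝒪_{X_s,x}` by flatness (EGA IV₂ 6.1.2); and
`dim 𝒪_{X_s,x} ≥ 1`, since otherwise the reduced (2.21: the fibres of a semi-stable curve are
reduced) zero-dimensional local ring `𝒪_{X_s,x}` is a field and `𝒪_{X,x}` is regular
(Matsumura 23.7 (ii)). ("… or by noting that `X` is normal": this is the `R₁` half of Serre's
criterion for `X`.) [cite: DeJong1996, 3.4, p. 63] -/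
theorem DeJong1996SemiStableSingCodimTwo_holds : DeJong1996SemiStableSingCodimTwo.{u} := by
  intro k _ _ X Y f g D n τ hS x hx
  haveI := hS.isIntegral
  haveI := hS.isNoetherian
  haveI := hS.isNoetherian_base
  haveI : Flat f := hS.isSemiStableCurve.flat
  haveI := hS.isSemiStableCurve.locallyOfFiniteType
  -- 3.1: `x ∈ Sing(f)`, in particular `f x ∈ D`
  have hsD : f x ∈ D := by
    by_contra hxD
    let V : Y.Opens := ⟨Dᶜ, hS.isStrictNormalCrossingsDivisor.isClosed.isOpen_compl⟩
    have hxV : x ∈ f ⁻¹ᵁ V := hxD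
    haveI : Smooth (f ∣_ V) := hS.smooth_morphismRestrict
    have hsm : Smooth ((f ⁻¹ᵁ V).ι ≫ f) := by
      rw [← morphismRestrict_ι]
      infer_instance
    exact hx (hS.isRegularLocalRing_of_smooth hsm hxV)
  -- `dim 𝒪_{Y, f x} ≥ 1`
  have hY1 : (1 : WithBot ℕ∞) ≤ ringKrullDim (Y.presheaf.stalk (f x)) := by
    obtain ⟨r, e, -, -, hr, hdim, -, -⟩ :=
      hS.isStrictNormalCrossingsDivisor.exists_regularSystemOfParameters hsD
    rw [hdim]
    exact_mod_cast (show 1 ≤ r + e by omega)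
  -- the fibre `X_{f x}` is reduced, locally Noetherian; its local ring at `x` has `dim ≥ 1`
  haveI : IsReduced (f.fiber (f x)) := hS.isSemiStableCurve.isReduced_fiber (f x)
  haveI : LocallyOfFiniteType (f.fiberToSpecResidueField (f x)) :=
    MorphismProperty.pullback_snd _ _ inferInstance
  haveI : IsLocallyNoetherian (f.fiber (f x)) :=
    LocallyOfFiniteType.isLocallyNoetherian (f.fiberToSpecResidueField (f x))
  have hR1 : (1 : WithBot ℕ∞) ≤ ringKrullDim ((f.fiber (f x)).presheaf.stalk (f.asFiber x)) := by
    by_contra hlt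
    have hle := ringKrullDim_le_zero_of_not_one_le
      ((f.fiber (f x)).presheaf.stalk (f.asFiber x)) hlt
    haveI : Ring.KrullDimLE 0 ((f.fiber (f x)).presheaf.stalk (f.asFiber x)) :=
      Ring.krullDimLE_iff.mpr hle
    have hF : IsField ((f.fiber (f x)).presheaf.stalk (f.asFiber x)) :=
      Ring.KrullDimLE.isField_of_isReduced
    exact hx (isRegularLocalRing_stalk_of_isField_stalk_fiber f x (hS.isRegular_base _) hF)
  -- EGA IV₂ 6.1.2: `dim 𝒪_{X,x} = dim 𝒪_{Y, f x} + dim 𝒪_{X_{f x}, x}`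
  have h3 := Literature.AlgebraicGeometry.Motives.coheight_eq_coheight_add_ringKrullDim_stalk_fiber f x
  rw [ringKrullDim_stalk_eq_coheight] at hY1 ⊢
  calc (2 : WithBot ℕ∞) = 1 + 1 := one_add_one_eq_two.symm
    _ ≤ (coheight (f x) : WithBot ℕ∞) +
          ringKrullDim ((f.fiber (f x)).presheaf.stalk (f.asFiber x)) := add_le_add hY1 hR1
    _ = coheight x := h3.symm

/-- **de Jong 1996, Lemma 3.2 from the Claim of 3.4 alone**: with `codim(Sing(X), X) ≥ 2`
discharged, `DeJong1996Lemma32` rests on the single named fact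
`DeJong1996SemiStableCodimTwoModification` (3.3–3.4). [cite: DeJong1996, 3.2–3.4, pp. 62–64] -/
theorem DeJong1996Lemma32.of_codimTwoModification
    (h1 : DeJong1996SemiStableCodimTwoModification.{u}) : DeJong1996Lemma32.{u} :=
  DeJong1996Lemma32.of_singCodimTwo_of_codimTwoModification
    DeJong1996SemiStableSingCodimTwo_holds h1

/-- `DeJong1996SemiStableCodimThree` (4.24, first sentence) from the Claim of 3.4 alone.
[cite: DeJong1996, 3.2–3.4 and 4.24, pp. 62–64, 75] -/
theorem DeJong1996SemiStableCodimThree.of_codimTwoModification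
    (h1 : DeJong1996SemiStableCodimTwoModification.{u}) : DeJong1996SemiStableCodimThree.{u} :=
  DeJong1996SemiStableCodimThree.of_singCodimTwo_of_codimTwoModification
    DeJong1996SemiStableSingCodimTwo_holds h1

/-- In Situation 4.23 the codimension-2 singular points of `X` form a finite set,
unconditionally. [cite: DeJong1996, 3.4, p. 63] -/
theorem DeJong1996.SemiStablePair.finite_singularLocusCodimLE_two' {k : Type u} [Field k]
    [IsAlgClosed k] {X Y : Scheme.{u}} {f : X ⟶ Y} {g : Y ⟶ Spec (.of k)} {D : Set Y} {n : ℕ}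
    {τ : Fin n → (Y ⟶ X)} (h : DeJong1996.SemiStablePair f g D τ) :
    (Scheme.singularLocusCodimLE X 2).Finite :=
  h.finite_singularLocusCodimLE_two DeJong1996SemiStableSingCodimTwo_holds

end Literature.AlgebraicGeometry.Resolution

end
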